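import Literature.Computability.AlgebraicComplexity.LaserFormatValue
import Literature.Computability.AlgebraicComplexity.LaserMethodValues
import HarnessLib

/-!
# The laser method in format currency (Coppersmith 1997 §3; Huang–Pan 1998 §3; Le Gall 2012 §3–§4, with Le Gall 2014 Thm. 4.1's penalty) — proved, rational distributions

Topic `Literature/Computability/AlgebraicComplexity`.  `LaserMethodValues.lean` proves Le Gall's
Theorem 4.1 — the laser method for a partitioned tensor with arbitrary components, a tight
support `S` and the penalty `Γ_S(P)` — in the SQUARE value currency `HasLaserValue ρ`.  This file
is the same theorem in the FORMAT currency `HasFormatValue` of `LaserFormatValue.lean`, which is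
what the rectangular analyses of the Coppersmith–Winograd powers use (Coppersmith 1997 §3,
Huang–Pan 1998 §3, Le Gall 2012 §3–§4: every component of the retained free diagonal is "a
matrix product of format `(∏ A_s^{N P(s)}, ∏ B_s^{N P(s)}, ∏ C_s^{N P(s)})`", and Schönhage's
rectangular asymptotic sum inequality, Le Gall 2012 Thm. 2.1, converts count and format into a
bound on `ω(1,k,1)`).  The tensor layer (free diagonal of one joint type, its cardinality
`2^{N(min_m H(P_m) − Γ_S(P)) − o(N)}`, blocks as Kronecker products of components) is the tree's
(`LaserMethodBlocks`, `LaserMethodTypeCount`); only the bookkeeping changes, from one real value to a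
count and three formats, all multiplicative.

Main results (for distributions `P = c/d` with rational values — the form in which every
published rectangular design is certified; the real-`P` statement follows by continuity of the
final bound and is not needed):

* `hasFormatValue_kroneckerPow_of_free_diagonal_of_block` — `t^{⊗N}` is worth `|Δ|` times the
  format value of one block, for a free diagonal `Δ` of blocks of one type;
* `laserMethod_hasFormatValue_of_blockValue` — **the core**: if every block of type `M c` is worth
  `W^{dM}` products of format `(A^{dM}, B^{dM}, C^{dM})`, then `t` is worth
  `2^{min_m H(P_m) − Γ_S(P)} · W` products of format `(A, B, C)`;
* `laserMethod_hasFormatValue_of_counts` — with component data `HasFormatValue (t(s)) v_s A_s B_s C_s`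
  (`s ∈ S`): `t` is worth `2^{min_m H(P_m) − Γ_S(P)} ∏_s v_s^{P(s)}` products of format
  `(∏_s A_s^{P(s)}, ∏_s B_s^{P(s)}, ∏_s C_s^{P(s)})` (Le Gall Thm. 4.1, format form);
* `omegaRect_one_mid_one_le_of_laserMethodFormat` — the reading through
  `omegaRect_one_mid_one_le_of_hasFormatValue`: `ω(1,k,1) ≤ log(R/V)/log A` when the outer formats
  agree, `A > 1`, `A^k ≤ B` and `R̃(t) ≤ R`.

Library fit: the proofs are those of `LaserMethodValues.laserMethod_hasLaserValue_of_blockValue` /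
`laserMethod_hasLaserValue` (rational case) with `HasLaserValue` replaced by `HasFormatValue`; no
new facts, no new definitions.  (Searched: `HasFormatValue`, `laserMethod_`, `omegaRect`,
`Rectangular` — the tree has no rectangular laser-method theorem with general components; the
matrix-component level-1 case for `CW_q` is `Summit…SaturationLadderLevelOne.omegaRect_cwSix_le`.)

## References

* D. Coppersmith, *Rectangular matrix multiplication revisited*, J. Complexity 13 (1997), §3.
  [Coppersmith1997]
* X. Huang, V. Y. Pan, *Fast rectangular matrix multiplication and applications*, J. Complexity 14
  (1998), §3. [HuangPan1998]
* F. Le Gall, *Faster algorithms for rectangular matrix multiplication*, FOCS 2012,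
  arXiv:1204.1111, Thm. 2.1, §3–§4. [LeGall2012]
* F. Le Gall, *Powers of tensors and fast matrix multiplication*, ISSAC 2014, arXiv:1401.7714,
  Thm. 4.1 and Appendix A.3. [LeGall2014]
-/

set_option autoImplicit false
set_option linter.style.longLine false
set_option linter.style.longFile 0
set_option linter.unusedSectionVars false
set_option linter.unusedVariables false

noncomputable section

open Finset
open scoped BigOperators

universe u

namespace Literature.Computability.AlgebraicComplexity

open Literature.Barriers.MatrixMultiplication

/-! ## A fixed power: free diagonal of one type -/

section FixedPower

variable {K : Type u} [Field K]
variable {ι κ μ : Type*} [Fintype ι] [Fintype κ] [Fintype μ] [DecidableEq ι] [DecidableEq κ]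
  [DecidableEq μ]
variable {I J L : Type*} [Fintype I] [Fintype J] [Fintype L] [DecidableEq I] [DecidableEq J]
  [DecidableEq L]

/-- **`t^{⊗N}` is worth `|Δ|` blocks** for a free diagonal `Δ` all of whose blocks have the type of
the word `w₀`: if the block `t^{⊗N}(w₀)` is worth `W` products of format `(X,Y,Z)` then `t^{⊗N}`
is worth `|Δ| W` such products (`t^{⊗N} ≥ ⟨|Δ|⟩ ⊗ t^{⊗N}(w₀)`, Le Gall (7)–(8), and
`HasFormatValue.multiple`). [cite: LeGall2014, Appendix A.3, Eqs. (7)–(8)] [cite: LeGall2012, §3] -/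
theorem hasFormatValue_kroneckerPow_of_free_diagonal_of_block (t : ι → κ → μ → K) (bI : ι → I)
    (bJ : κ → J) (bL : μ → L) (S : Finset (I × J × L))
    (hS : ∀ a b c, t a b c ≠ 0 → (bI a, bJ b, bL c) ∈ S)
    {N : ℕ} (Δ : Finset ((Fin N → I) × (Fin N → J) × (Fin N → L)))
    (hfree : ∀ δ ∈ Δ, ∀ δ' ∈ Δ, ∀ δ'' ∈ Δ, (∀ q, (δ.1 q, δ'.2.1 q, δ''.2.2 q) ∈ S) →
      δ = δ' ∧ δ' = δ'')
    (w₀ : Fin N → I × J × L) (htype : ∀ δ ∈ Δ, letterCount (labelSeq δ) = letterCount w₀)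
    {W X Y Z : ℝ} (hW : HasFormatValue (laserBlock bI bJ bL t w₀) W X Y Z) :
    HasFormatValue (kroneckerPow t N) (Δ.card * W) X Y Z :=
  (hW.multiple Δ.card).of_restrictsTo
    (tensorRestrictsTo_kroneckerPow_multiple_laserBlock t bI bJ bL S hS Δ hfree w₀ htype)

end FixedPower

/-! ## The core: distributions with a common denominator, blocks with a format value -/

section Rational

variable {K : Type u} [Field K]
variable {ι κ μ : Type*} [Fintype ι] [Fintype κ] [Fintype μ] [DecidableEq ι] [DecidableEq κ]
  [DecidableEq μ]
variable {I J L : Type*} [Fintype I] [Fintype J] [Fintype L] [DecidableEq I] [DecidableEq J]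
  [DecidableEq L]

/-- **The core of the rectangular laser method, for `P = c/d`, with an abstract format value for
the blocks** (Le Gall Thm. 4.1 in format currency).  If every block `t^{⊗ dM}(w)` whose label
word `w` has type `M c` is worth `W^{dM}` products of format `(A^{dM}, B^{dM}, C^{dM})` (`W > 0`,
`A, B, C ≥ 0`), then `t` is worth `2^{min_m H(P_m) − Γ_S(P)} · W` products of format `(A, B, C)`.
Proof = the tree's `laserMethod_hasLaserValue_of_blockValue` with the count in place of the value:
the free diagonal of type `Mc` (`exists_free_diagonal_jointType_card`) has
`2^{N(min H − Γ)} ≤ |Δ| J(N)`, `log J(N) = o(N)`; `t^{⊗N}` is worth `|Δ| W^N` blocks of format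
`(A^N, B^N, C^N)`; take `N`-th roots (`HasFormatValue.of_kroneckerPow`, exact on the formats) along
`N` with `J(N) ≤ θ^N`. [cite: LeGall2014, Thm. 4.1 (proof, Appendix A.3)] [cite: LeGall2012, §3]
[cite: Coppersmith1997, §3] -/
theorem laserMethod_hasFormatValue_of_blockValue (t : ι → κ → μ → K) (bI : ι → I) (bJ : κ → J)
    (bL : μ → L) (S : Finset (I × J × L)) (hS : ∀ a b c, t a b c ≠ 0 → (bI a, bJ b, bL c) ∈ S)
    {r b : ℕ} (α : I → Fin r → ℤ) (β : J → Fin r → ℤ) (γ : L → Fin r → ℤ)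
    (hα : Function.Injective α) (hβ : Function.Injective β) (hγ : Function.Injective γ)
    (hαb : ∀ i k, |α i k| ≤ b) (hβb : ∀ j k, |β j k| ≤ b)
    (htight : ∀ s ∈ S, ∀ k, α s.1 k + β s.2.1 k + γ s.2.2 k = 0)
    (c : I × J × L → ℕ) (hcS : ∀ s, s ∉ S → c s = 0) {d : ℕ} (hd : 0 < d)
    (hc : ∑ s, c s = d) (P : I × J × L → ℝ) (hP : ∀ s, P s = (c s : ℝ) / d)
    {W A B C : ℝ} (hW0 : 0 < W) (hA : 0 ≤ A) (hB : 0 ≤ B) (hC : 0 ≤ C)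
    (hW : ∀ M : ℕ, 0 < M → ∀ w : Fin (d * M) → I × J × L, (letterCount w = fun s => M * c s) →
      HasFormatValue (laserBlock bI bJ bL t w) (W ^ (d * M)) (A ^ (d * M)) (B ^ (d * M))
        (C ^ (d * M))) :
    HasFormatValue t ((2 : ℝ) ^ (min (shannonEntropy (marginalDist₁ P))
        (min (shannonEntropy (marginalDist₂ P)) (shannonEntropy (marginalDist₃ P))) -
        maxEntropyPenalty S P) * W) A B C := by
  classical
  -- notation
  set E : ℝ := min (shannonEntropy (marginalDist₁ P))
      (min (shannonEntropy (marginalDist₂ P)) (shannonEntropy (marginalDist₃ P))) -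
    maxEntropyPenalty S P with hE
  have h2E : 0 < (2 : ℝ) ^ E := Real.rpow_pos_of_pos two_pos _
  have hvs : 0 < (2 : ℝ) ^ E * W := mul_pos h2E hW0
  refine hasFormatValue_of_forall_lt fun v' hv'0 hv'lt => ?_
  rcases hv'0.eq_or_lt with h0 | hv'pos
  · rw [← h0]; exact hasFormatValue_of_nonpos t le_rfl A B C
  -- `θ = v*/v' > 1`
  set θ : ℝ := (2 : ℝ) ^ E * W / v' with hθ
  have hθ1 : 1 < θ := (one_lt_div hv'pos).2 hv'lt
  have hθ0 : 0 < θ := one_pos.trans hθ1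
  have hlogθ : 0 < Real.log θ := Real.log_pos hθ1
  -- constants of the counting bound
  set G : ℕ := Fintype.card (I × J × L) with hG
  set A' : ℕ := Fintype.card I + Fintype.card J + Fintype.card L with hA'
  set b' : ℕ := max b 1 with hb'
  have hb'1 : (1 : ℝ) ≤ b' := by exact_mod_cast (le_max_right b 1)
  have hu : 0 ≤ Real.log ((3 * b' : ℕ) : ℝ) := Real.log_natCast_nonneg _
  have hlogG : 0 ≤ Real.log (G : ℝ) := Real.log_natCast_nonneg _
  obtain ⟨M, hM1, hM⟩ := exists_errTerm_le_mul (a := ((2 * G + A' : ℕ) : ℝ)) (e := 4)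
    (w := Real.log (96 * (b' : ℝ))) (Nat.cast_nonneg _) (by norm_num) hu hlogG hlogθ hd
  have hM0 : 0 < M := by omega
  -- the block format value at the words of type `M c`
  have hWM := hW M hM0
  -- the power `N = d M` and the count vector `Q = M c`
  obtain ⟨N, hN⟩ : ∃ N : ℕ, N = d * M := ⟨_, rfl⟩
  rw [← hN] at hM hWM
  have hN0 : 0 < N := hN ▸ Nat.mul_pos hd hM0
  have hN0' : (0 : ℝ) < N := by exact_mod_cast hN0
  set Q : I × J × L → ℕ := fun s => M * c s with hQ
  have hQS : ∀ s, s ∉ S → Q s = 0 := fun s hs => by simp [hQ, hcS s hs]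
  have hQsum : ∑ s, Q s = N := by
    simp only [hQ]; rw [← Finset.mul_sum, hc, hN, mul_comm]
  have hPQ : ∀ s, P s = (Q s : ℝ) / N := by
    intro s
    rw [hP, hQ, hN]
    push_cast
    have hd0 : (d : ℝ) ≠ 0 := by exact_mod_cast hd.ne'
    have hM0' : (M : ℝ) ≠ 0 := by exact_mod_cast hM0.ne'
    field_simp
  -- the free diagonal of type `Q`
  obtain ⟨Δ, hΔQ, hfree, hcount⟩ := exists_free_diagonal_jointType_card S α β γ hα hβ hγ hαb hβb
    htight hN0 Q hQS hQsum P hPQ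
  rw [← hE] at hcount
  -- the junk factor is `≤ θ^N`
  set Jf : ℝ := ((N : ℝ) + 1) ^ (2 * Fintype.card (I × J × L) +
      (Fintype.card I + Fintype.card J + Fintype.card L)) * (96 * ((max b 1 : ℕ) : ℝ)) *
    Real.exp (4 * √(Real.log ((3 * max b 1 : ℕ) : ℝ) +
      (N : ℝ) * Real.log (Fintype.card (I × J × L) : ℝ))) with hJf
  have hJpos : 0 < Jf := by positivity
  have hJθ : Jf ≤ θ ^ N := by
    rw [← Real.exp_log hJpos, ← Real.exp_log (pow_pos hθ0 N), Real.exp_le_exp, Real.log_pow]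
    have hlogJ : Real.log Jf = ((2 * G + A' : ℕ) : ℝ) * Real.log ((N : ℝ) + 1) +
        Real.log (96 * (b' : ℝ)) +
        4 * √(Real.log ((3 * b' : ℕ) : ℝ) + (N : ℝ) * Real.log (G : ℝ)) := by
      rw [hJf, Real.log_mul (by positivity) (by positivity),
        Real.log_mul (by positivity) (by positivity), Real.log_exp, Real.log_pow, hG, hA', hb']
    rw [hlogJ, show (N : ℝ) * Real.log (G : ℝ) = Real.log (G : ℝ) * N from mul_comm _ _]
    linarith [hM]
  -- a word of type `Q` and the format value of the power
  obtain ⟨w₀, hw₀⟩ := typeClass_nonempty N Q hQsum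
  rw [mem_typeClass] at hw₀
  have hblock := hasFormatValue_kroneckerPow_of_free_diagonal_of_block t bI bJ bL S hS Δ hfree w₀
    (fun δ hδ => by rw [hw₀]; exact (Finset.mem_filter.1 (hΔQ hδ)).2) (hWM w₀ hw₀)
  have hroot := HasFormatValue.of_kroneckerPow (Nat.one_le_iff_ne_zero.2 hN0.ne') hblock
    (by positivity) (by positivity) (by positivity) (by positivity)
  rw [Real.pow_rpow_inv_natCast hA hN0.ne', Real.pow_rpow_inv_natCast hB hN0.ne',
    Real.pow_rpow_inv_natCast hC hN0.ne'] at hroot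
  refine hroot.mono hv'0 ?_ hA le_rfl hB le_rfl hC le_rfl
  -- `v' ≤ (|Δ| W^N)^{1/N}` because `v'^N θ^N = (2^E W)^N ≤ |Δ| J W^N ≤ |Δ| θ^N W^N`
  have hvθ : v' * θ = (2 : ℝ) ^ E * W := by
    rw [hθ]; field_simp
  have h2EN : ((2 : ℝ) ^ E) ^ N = (2 : ℝ) ^ ((N : ℝ) * E) := by
    rw [← Real.rpow_natCast ((2 : ℝ) ^ E) N, ← Real.rpow_mul zero_le_two, mul_comm]
  have key : v' ^ N ≤ Δ.card * W ^ N := by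
    have h1 : v' ^ N * θ ^ N ≤ (Δ.card * W ^ N) * θ ^ N :=
      calc v' ^ N * θ ^ N = (v' * θ) ^ N := (mul_pow _ _ _).symm
        _ = (2 : ℝ) ^ ((N : ℝ) * E) * W ^ N := by rw [hvθ, mul_pow, h2EN]
        _ ≤ (Δ.card * Jf) * W ^ N := mul_le_mul_of_nonneg_right hcount (pow_nonneg hW0.le N)
        _ ≤ (Δ.card * θ ^ N) * W ^ N := by gcongr
        _ = (Δ.card * W ^ N) * θ ^ N := by ring
    exact le_of_mul_le_mul_right h1 (pow_pos hθ0 N)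
  calc v' = (v' ^ N) ^ ((N : ℝ)⁻¹) := (Real.pow_rpow_inv_natCast hv'0 hN0.ne').symm
    _ ≤ ((Δ.card : ℝ) * W ^ N) ^ ((N : ℝ)⁻¹) :=
        Real.rpow_le_rpow (pow_nonneg hv'0 N) key (inv_nonneg.2 (Nat.cast_nonneg N))

/-- **The rectangular laser method with component data (Le Gall Thm. 4.1, format form), for
`P = c/d`.**  Let `t` be a tensor over a field with block labels `bI, bJ, bL`, tight support
`S ⊇ supp_D t` (injective `α, β, γ : · → ℤ^r`, `α i + β j + γ l = 0` on `S`), and let every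
component `t(s)` (`s ∈ S`) be worth `v_s > 0` products of format `(A_s, B_s, C_s)` (all `> 0`).
Then for the distribution `P = c/d` on `S`, `t` is worth `2^{min_m H(P_m) − Γ_S(P)} ∏_s v_s^{P(s)}`
products of format `(∏_s A_s^{P(s)}, ∏_s B_s^{P(s)}, ∏_s C_s^{P(s)})` — the blocks of type `Mc` are
`⊗_q t(w_q)`, worth `∏_q v_{w_q} = (∏_s v_s^{P(s)})^{dM}` products of format
`((∏_s A_s^{P(s)})^{dM}, …)` by `HasFormatValue.kroneckerPi`.  (Coppersmith 1997 §3 and Le Gall 2012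
§3–§4 run this recursion for `CW_q ⊗ CW_q` with matrix and `𝒞`-tensor components.)
[cite: LeGall2014, Thm. 4.1] [cite: LeGall2012, §3] [cite: Coppersmith1997, §3] -/
theorem laserMethod_hasFormatValue_of_counts (t : ι → κ → μ → K) (bI : ι → I) (bJ : κ → J)
    (bL : μ → L) (S : Finset (I × J × L)) (hS : ∀ a b c, t a b c ≠ 0 → (bI a, bJ b, bL c) ∈ S)
    {r b : ℕ} (α : I → Fin r → ℤ) (β : J → Fin r → ℤ) (γ : L → Fin r → ℤ)
    (hα : Function.Injective α) (hβ : Function.Injective β) (hγ : Function.Injective γ)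
    (hαb : ∀ i k, |α i k| ≤ b) (hβb : ∀ j k, |β j k| ≤ b)
    (htight : ∀ s ∈ S, ∀ k, α s.1 k + β s.2.1 k + γ s.2.2 k = 0)
    (v fA fB fC : I × J × L → ℝ) (hv : ∀ s ∈ S, 0 < v s) (hfA : ∀ s ∈ S, 0 < fA s)
    (hfB : ∀ s ∈ S, 0 < fB s) (hfC : ∀ s ∈ S, 0 < fC s)
    (hval : ∀ s ∈ S, HasFormatValue (partSubtensor bI bJ bL t {s.1} {s.2.1} {s.2.2}) (v s)
      (fA s) (fB s) (fC s))
    (c : I × J × L → ℕ) (hcS : ∀ s, s ∉ S → c s = 0) {d : ℕ} (hd : 0 < d)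
    (hc : ∑ s, c s = d) (P : I × J × L → ℝ) (hP : ∀ s, P s = (c s : ℝ) / d) :
    HasFormatValue t ((2 : ℝ) ^ (min (shannonEntropy (marginalDist₁ P))
        (min (shannonEntropy (marginalDist₂ P)) (shannonEntropy (marginalDist₃ P))) -
        maxEntropyPenalty S P) * ∏ s ∈ S, v s ^ P s)
      (∏ s ∈ S, fA s ^ P s) (∏ s ∈ S, fB s ^ P s) (∏ s ∈ S, fC s ^ P s) := by
  classical
  have hPc : ∀ f : I × J × L → ℝ, ∏ s ∈ S, f s ^ P s = ∏ s ∈ S, f s ^ ((c s : ℝ) / d) :=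
    fun f => Finset.prod_congr rfl fun s _ => by rw [hP]
  rw [hPc v, hPc fA, hPc fB, hPc fC]
  have hpos : ∀ f : I × J × L → ℝ, (∀ s ∈ S, 0 < f s) → 0 < ∏ s ∈ S, f s ^ ((c s : ℝ) / d) :=
    fun f hf => Finset.prod_pos fun s hs => Real.rpow_pos_of_pos (hf s hs) _
  refine laserMethod_hasFormatValue_of_blockValue t bI bJ bL S hS α β γ hα hβ hγ hαb hβb htight
    c hcS hd hc P hP (hpos v hv) (hpos fA hfA).le (hpos fB hfB).le (hpos fC hfC).le
    fun M hM w hw => ?_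
  -- the letters of `w` lie in `S`
  have hwS : ∀ q, w q ∈ S := fun q => by
    by_contra h'
    have h0 : letterCount w (w q) = 0 := by rw [hw]; simp [hcS _ h']
    exact (letterCount_pos_of_apply w q).ne' h0
  have hkp := HasFormatValue.kroneckerPi (fun q => hval _ (hwS q)) (fun q => (hv _ (hwS q)).le)
    (fun q => (hfA _ (hwS q)).le) (fun q => (hfB _ (hwS q)).le) (fun q => (hfC _ (hwS q)).le)
  rwa [prod_apply_word_eq_pow S v hv c hcS hd w hw, prod_apply_word_eq_pow S fA hfA c hcS hd w hw,
    prod_apply_word_eq_pow S fB hfB c hcS hd w hw, prod_apply_word_eq_pow S fC hfC c hcS hd w hw]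
    at hkp

end Rational

/-! ## The reading: a bound on `ω(1,k,1)` -/

section Omega

variable {K : Type} [Field K]
variable {ι κ μ : Type} [Fintype ι] [Fintype κ] [Fintype μ] [DecidableEq ι] [DecidableEq κ]
  [DecidableEq μ]
variable {I J L : Type} [Fintype I] [Fintype J] [Fintype L] [DecidableEq I] [DecidableEq J]
  [DecidableEq L]

/-- **Corollary (Le Gall 2012 Thm. 2.1 with the format laser method): the bound on `ω(1,k,1)`.**
In the setting of `laserMethod_hasFormatValue_of_counts`, write `V = 2^{min_m H(P_m) − Γ_S(P)}
∏_s v_s^{P(s)}` and `A = ∏_s A_s^{P(s)}`, `B = ∏_s B_s^{P(s)}`; if the outer formats agree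
(`∏_s C_s^{P(s)} = A`), `1 < A`, `0 ≤ k`, `A^k ≤ B` and `R̃(t) ≤ R`, then
`ω(1,k,1) ≤ log(R/V)/log A`. [cite: LeGall2012, Thm. 2.1 and §3] [cite: LeGall2014, Thm. 4.1] -/
theorem omegaRect_one_mid_one_le_of_laserMethodFormat (t : ι → κ → μ → K) (bI : ι → I)
    (bJ : κ → J) (bL : μ → L) (S : Finset (I × J × L))
    (hS : ∀ a b c, t a b c ≠ 0 → (bI a, bJ b, bL c) ∈ S)
    {r b : ℕ} (α : I → Fin r → ℤ) (β : J → Fin r → ℤ) (γ : L → Fin r → ℤ)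
    (hα : Function.Injective α) (hβ : Function.Injective β) (hγ : Function.Injective γ)
    (hαb : ∀ i k, |α i k| ≤ b) (hβb : ∀ j k, |β j k| ≤ b)
    (htight : ∀ s ∈ S, ∀ k, α s.1 k + β s.2.1 k + γ s.2.2 k = 0)
    (v fA fB fC : I × J × L → ℝ) (hv : ∀ s ∈ S, 0 < v s) (hfA : ∀ s ∈ S, 0 < fA s)
    (hfB : ∀ s ∈ S, 0 < fB s) (hfC : ∀ s ∈ S, 0 < fC s)
    (hval : ∀ s ∈ S, HasFormatValue (partSubtensor bI bJ bL t {s.1} {s.2.1} {s.2.2}) (v s)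
      (fA s) (fB s) (fC s))
    (c : I × J × L → ℕ) (hcS : ∀ s, s ∉ S → c s = 0) {d : ℕ} (hd : 0 < d)
    (hc : ∑ s, c s = d) (P : I × J × L → ℝ) (hP : ∀ s, P s = (c s : ℝ) / d)
    {k R : ℝ} (hk : 0 ≤ k) (hR : asymptoticRank t ≤ R)
    (hsym : ∏ s ∈ S, fC s ^ P s = ∏ s ∈ S, fA s ^ P s) (hA1 : 1 < ∏ s ∈ S, fA s ^ P s)
    (hAB : (∏ s ∈ S, fA s ^ P s) ^ k ≤ ∏ s ∈ S, fB s ^ P s) :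
    omegaRect K 1 k 1 ≤ Real.log (R / ((2 : ℝ) ^ (min (shannonEntropy (marginalDist₁ P))
        (min (shannonEntropy (marginalDist₂ P)) (shannonEntropy (marginalDist₃ P))) -
        maxEntropyPenalty S P) * ∏ s ∈ S, v s ^ P s)) / Real.log (∏ s ∈ S, fA s ^ P s) := by
  have h := laserMethod_hasFormatValue_of_counts t bI bJ bL S hS α β γ hα hβ hγ hαb hβb htight
    v fA fB fC hv hfA hfB hfC hval c hcS hd hc P hP
  rw [hsym] at h
  have hV : 0 < (2 : ℝ) ^ (min (shannonEntropy (marginalDist₁ P))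
        (min (shannonEntropy (marginalDist₂ P)) (shannonEntropy (marginalDist₃ P))) -
        maxEntropyPenalty S P) * ∏ s ∈ S, v s ^ P s :=
    mul_pos (Real.rpow_pos_of_pos two_pos _)
      (Finset.prod_pos fun s hs => Real.rpow_pos_of_pos (hv s hs) _)
  exact omegaRect_one_mid_one_le_of_hasFormatValue h hA1 hk hAB hV hR

end Omega

end Literature.Computability.AlgebraicComplexity

end
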